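import Summits.HubbardSuperconductivity.HubbardSuperconductivity.Theses.ThermalWedge
import Summits.HubbardSuperconductivity.HubbardSuperconductivity.Theorems.TwTipContinuation.Negative.SeededChords
import Summits.HubbardSuperconductivity.HubbardSuperconductivity.Theorems.TwSeededEnsembleEquivalence.Negative.ObstructionTemplates
import Literature.MathematicalPhysics.QuantumLattice.ApproximatingHamiltonianProofs

/-!
# Route `ThermalWedge` — the ANCHOR `TwSeededRung` (stmt-HubbardSuperconductivity-1699)

`TwSeededRung`: for `δ ∈ [1/10, 2/5]` there are `U₀, K > 0` (`K·U₀ ≤ 1/20`) such that for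
`0 < U ≤ U₀` and every seed `g ∈ [K·U, 1/10]` every normalised `(N_L, S^z = 0)`-sector ground state
`ψ` of the seeded repulsive Hubbard torus `H_L(U,g) = hubbardTorus 2 L 1 U − (g/L²)·P_L`,
`P_L = (pairField d L)ᴴ(pairField d L)`, has `⟨ψ, P_L ψ⟩ ≥ c(U,g)·L⁴` eventually in (even) `L`.

This file proves the anchor FROM TWO OF THE ROUTE'S CRUXES ONLY,

  `twSeededRung_of_condensation : TwSourcedCondensation → TwSeededEnsembleEquivalence → TwSeededRung`,

sharpening the route's glue `TwRungGlue` (`Theorems/ThermalWedgeTwRungGlue.lean`, which also consumes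
`TwSectorEnergyLowerBound`, both halves of `TwApproximatingHamiltonian` and the crux
`TwSourcedInertness`): the rung chord is taken from the PURE model, `g' = 0`, where the sector
energy needs no inertness —

* chord (`leftChord_le_order`, `SeededChords.lean`): `(g/L²)·⟨ψ,P_Lψ⟩ ≥ E_L(0) − E_L(g)`;
* `E_L(0) ≥ μN_L − β⁻¹ log Z(β, hubbardTorusWith 2 L 1 U μ)` for EVERY `μ, β` — the trivial Gibbs
  bound on a sector ground state (`tw_sectorEnergy_zero_lower_bound`, from
  `seeded_sector_rayleigh_lower_bound` of `ObstructionTemplates.lean`);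
* `E_L(g) ≤ μN_L − L² p_L(β,μ,U,g) + L²(log 4/β + ε)` at the canonical `μ ∈ [μ₁,μ₂]`
  (`TwSeededEnsembleEquivalence`);
* `p_L(β,μ,U,g) ≥ p̃_L(β,μ,U,s) − s²/g` for every real source `s` — the EASY half of the
  approximating-Hamiltonian theorem, proved here for the `d`-wave-seeded torus
  (`tw_sourcedPressure_sub_sq_le_seededPressure`, from the tree's completed square
  `log_partitionFn_approx_le_model`, Bru–Pedra 2013 App., Thm 107 lower bound);
* `p̃_L(s) − p̃_L(0) ≥ c s² log(1/(|s| + 1/β)) − C s²` (`TwSourcedCondensation`).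

Constants: given `δ`, `(μ₁,μ₂,U₀ᵉ)` from ensemble equivalence and `(U₀ᶜ,a,c,C,h₀)` from
condensation on `[μ₁,μ₂]`; `β := e^{a/U}`, probe source `s := e^{-a/(4U)}` (so
`log(1/(|s|+1/β)) ≥ a/(4U) − log 2`), allowance `ε := c a s²/(32U)`, `K := 16/(ca)` (so
`1/g ≤ ca/(16U)` on `[K·U, 1/10]`), `U₀ := min {U₀ᵉ, U₀ᶜ, 1/(20K), a h₀/4, ca/(32(c log 2 + C +
log 4))}`; margin `E_L(0) − E_L(g) ≥ L²·c a s²/(8U)`, hence `⟨ψ,P_Lψ⟩ ≥ (c a s²/(8Ug))·L⁴`.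

Consequence: the route's glue `TwRungGlue` holds with three of its five hypotheses unused
(`fun _ _ _ hC hE => twSeededRung_of_condensation hC hE`; not restated here, the item is closed by
`twRungGlue_proof`), and the route's kill criterion (a) (refutation of `TwSourcedInertness`) no
longer takes the rungs with it — inertness is needed by the ceiling only.
-/

namespace Summit.HubbardSuperconductivity.HubbardSuperconductivity.Theorems

open Literature.MathematicalPhysics.QuantumLattice Matrix
open Summit.HubbardSuperconductivity.HubbardSuperconductivity.Theses.ThermalWedge
open Summit.HubbardSuperconductivity.TwTipContinuation.Negative
open Summit.HubbardSuperconductivity.HubbardSuperconductivity.Theorems.TwSeededEnsembleEquivalence.Negative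
open scoped ComplexOrder Matrix.Norms.L2Operator

section EasyHalf

variable (L : ℕ) [NeZero L]

/-- **Approximating-Hamiltonian theorem, easy half, for the `d`-wave-seeded Hubbard torus**
(extensive form): `log Z(β, H_{L,h}) − βL²h²/g ≤ log Z(β, hubbardTorusWith − (g/L²)ΔᴴΔ)` for every
real source `h`, `g > 0`, `β ≥ 0` — the completed square
`(g/L²)(Δ − (hL²/g))ᴴ(Δ − (hL²/g)) ≥ 0` and monotonicity of the free energy
(`log_partitionFn_approx_le_model` with `T = hubbardTorusWith`, channel `√g·Δ`, `c = h/√g`).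
[cite: BruPedra2013, Appendix: The approximating Hamiltonian method, Theorem 107 (lower bound)] -/
theorem tw_log_partitionFn_source_sub_le_seeded (U μ : ℝ) {β g : ℝ} (hβ : 0 ≤ β) (hg : 0 < g)
    (h : ℝ) :
    Real.log (partitionFn β (dWaveSourceTorus L U μ h)).re - β * (L : ℝ) ^ 2 * (h ^ 2 / g) ≤
      Real.log (partitionFn β (hubbardTorusWith 2 L 1 U μ - ((g / (L : ℝ) ^ 2 : ℝ) : ℂ) •
        ((pairField dWaveFormFactor L)ᴴ * pairField dWaveFormFactor L))).re := by
  have hL : (0 : ℝ) < (L : ℝ) ^ 2 := by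
    have := NeZero.pos L
    positivity
  have hsg : 0 < Real.sqrt g := Real.sqrt_pos.2 hg
  have hsg0 : (Real.sqrt g : ℂ) ≠ 0 := by exact_mod_cast hsg.ne'
  have key := log_partitionFn_approx_le_model (isHermitian_hubbardTorusWith L 1 U μ)
    ((Real.sqrt g : ℂ) • pairField dWaveFormFactor L) hβ hL ((h / Real.sqrt g : ℝ) : ℂ)
  -- identify the approximating Hamiltonian with the sourced torus Hamiltonian
  have e1 : hubbardTorusWith 2 L 1 U μ -
      (starRingEnd ℂ ((h / Real.sqrt g : ℝ) : ℂ) • ((Real.sqrt g : ℂ) • pairField dWaveFormFactor L) +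
        ((h / Real.sqrt g : ℝ) : ℂ) • ((Real.sqrt g : ℂ) • pairField dWaveFormFactor L)ᴴ) =
      dWaveSourceTorus L U μ h := by
    have hc : ((h / Real.sqrt g : ℝ) : ℂ) * (Real.sqrt g : ℂ) = (h : ℂ) := by
      push_cast
      field_simp
    rw [Complex.conj_ofReal, conjTranspose_smul, smul_smul, smul_smul, Complex.star_def,
      Complex.conj_ofReal, hc, dWaveSourceTorus, smul_add]
  -- identify the model Hamiltonian with the seeded grand-canonical Hamiltonian
  have e2 : hubbardTorusWith 2 L 1 U μ - ((((L : ℝ) ^ 2)⁻¹ : ℝ) : ℂ) •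
      (((Real.sqrt g : ℂ) • pairField dWaveFormFactor L)ᴴ *
        ((Real.sqrt g : ℂ) • pairField dWaveFormFactor L)) =
      hubbardTorusWith 2 L 1 U μ - ((g / (L : ℝ) ^ 2 : ℝ) : ℂ) •
        ((pairField dWaveFormFactor L)ᴴ * pairField dWaveFormFactor L) := by
    have hgg : (Real.sqrt g : ℂ) * (Real.sqrt g : ℂ) = (g : ℂ) := by
      rw [← Complex.ofReal_mul, Real.mul_self_sqrt hg.le]
    rw [conjTranspose_smul, Complex.star_def, Complex.conj_ofReal, smul_mul_smul_comm, hgg,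
      smul_smul]
    congr 2
    push_cast
    field_simp
  -- the penalty `|c|² = h²/g`
  have e3 : ‖((h / Real.sqrt g : ℝ) : ℂ)‖ ^ 2 = h ^ 2 / g := by
    rw [Complex.norm_real, Real.norm_eq_abs, sq_abs, div_pow, Real.sq_sqrt hg.le]
  rw [e1, e2, e3] at key
  exact key

/-- **Approximating-Hamiltonian theorem, easy half** (pressure form, every `L`):
`p̃_L(β,μ,U,h) − h²/g ≤ p_L(β,μ,U,g)` for all real `h` (`β > 0`, `g > 0`) — the first conjunct of
the route's `TwApproximatingHamiltonian`.
[cite: BruPedra2013, Appendix: The approximating Hamiltonian method, Theorem 107 (lower bound)] -/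
theorem tw_sourcedPressure_sub_sq_le_seededPressure (U μ : ℝ) {β g : ℝ} (hβ : 0 < β)
    (hg : 0 < g) (h : ℝ) :
    Real.log (partitionFn β (dWaveSourceTorus L U μ h)).re / (β * (L : ℝ) ^ 2) - h ^ 2 / g ≤
      Real.log (partitionFn β (hubbardTorusWith 2 L 1 U μ - ((g / (L : ℝ) ^ 2 : ℝ) : ℂ) •
        ((pairField dWaveFormFactor L)ᴴ * pairField dWaveFormFactor L))).re /
          (β * (L : ℝ) ^ 2) := by
  have hL : (0 : ℝ) < (L : ℝ) ^ 2 := by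
    have := NeZero.pos L
    positivity
  have hβL : 0 < β * (L : ℝ) ^ 2 := mul_pos hβ hL
  have key := div_le_div_of_nonneg_right
    (tw_log_partitionFn_source_sub_le_seeded L U μ hβ.le hg h) hβL.le
  rwa [sub_div, mul_div_cancel_left₀ _ hβL.ne'] at key

end EasyHalf

section Bookkeeping

/-- **Sector lower bound at the pure model** (the trivial half of the one-point Legendre
inequality, at `g = 0`, in the literal vocabulary of the rung chord): for `n ≤ |Λ_L|`, every `μ`
and every `β ≥ 0`,
`β (μ·2n − E_L(0)) ≤ log Re Z(β, hubbardTorusWith 2 L 1 U μ)`, where `E_L(0)` is the sector energy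
of `hubbardTorus − (0/L²)•P_L` in the sector `(2n, S^z = 0)` (a normalised sector ground state
exists, and its Rayleigh quotient is a Gibbs lower bound). [folklore] -/
theorem tw_sectorEnergy_zero_lower_bound (L : ℕ) [NeZero L] (U μ : ℝ) {β : ℝ} (hβ : 0 ≤ β)
    {n : ℕ} (hn : n ≤ Fintype.card (FermionTorus 2 L)) :
    β * (μ * ((2 * n : ℕ) : ℝ) -
      Matrix.minEnergyOn (hubbardTorus 2 L 1 U - ((0 / (L : ℝ) ^ 2 : ℝ) : ℂ) •
        ((pairField dWaveFormFactor L)ᴴ * pairField dWaveFormFactor L)) (szSector (2 * n) 0)) ≤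
      Real.log (partitionFn β (hubbardTorusWith 2 L 1 U μ)).re := by
  obtain ⟨ψ₀, hψ₀, hgs₀⟩ := exists_unit_groundState U 0 L hn
  have hN : IsNParticle (2 * n) ψ₀ := ((mem_szSector_iff _ _ ψ₀).1 hgs₀.1).1
  have key := seeded_sector_rayleigh_lower_bound L U μ 0 hβ hN hψ₀
  have he : (star ψ₀ ⬝ᵥ (hubbardTorus 2 L 1 U - ((0 / (L : ℝ) ^ 2 : ℝ) : ℂ) •
      ((pairField dWaveFormFactor L)ᴴ * pairField dWaveFormFactor L)) *ᵥ ψ₀).re =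
      Matrix.minEnergyOn (hubbardTorus 2 L 1 U - ((0 / (L : ℝ) ^ 2 : ℝ) : ℂ) •
        ((pairField dWaveFormFactor L)ᴴ * pairField dWaveFormFactor L)) (szSector (2 * n) 0) := by
    change (expect _ ψ₀).re = _
    rw [expect_eq_of_groundState L hψ₀ hgs₀, Complex.ofReal_re]
  have h0 : hubbardTorusWith 2 L 1 U μ - ((0 / (L : ℝ) ^ 2 : ℝ) : ℂ) •
      ((pairField dWaveFormFactor L)ᴴ * pairField dWaveFormFactor L) = hubbardTorusWith 2 L 1 U μ := by
    simp only [zero_div, Complex.ofReal_zero, zero_smul, sub_zero]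
  rw [he, h0] at key
  exact key

/-- Intensive form of a Gibbs lower bound: `β(μN − E₀) ≤ Λ₀` gives
`μN/L² − Λ₀/(βL²) ≤ E₀/L²`. [folklore] -/
theorem tw_lower_aux {β μN E₀ Λ₀ L : ℝ} (hβ : 0 < β) (hL : 0 < L) (h : β * (μN - E₀) ≤ Λ₀) :
    μN / L ^ 2 - Λ₀ / (β * L ^ 2) ≤ E₀ / L ^ 2 := by
  have hL2 : 0 < L ^ 2 := by positivity
  have h1 : μN - E₀ ≤ Λ₀ / β := by
    rw [le_div_iff₀ hβ]
    linarith
  have h2 : (μN - Λ₀ / β) / L ^ 2 ≤ E₀ / L ^ 2 := div_le_div_of_nonneg_right (by linarith) hL2.le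
  rwa [sub_div, div_div] at h2

/-- The real-arithmetic core of the rung from the pure model (`g' = 0`): chord + sector lower bound
at `g = 0` + seeded ensemble equivalence at `g` + approximating Hamiltonian (easy half) +
condensation give `(m/g)·L⁴ ≤ ⟨P⟩` for any margin `m ≤ X − h²/g − log4/β − ε`. [folklore] -/
theorem twRung_bookkeeping_zero {E₀ E P p₀ pg ph n L g lb ε X m hsq : ℝ} (hL : 0 < L)
    (hg : 0 < g) (hchord : E₀ - E ≤ (g - 0) / L ^ 2 * P) (hlow : n - p₀ ≤ E₀ / L ^ 2)
    (hup : E / L ^ 2 + pg - n ≤ lb + ε) (hahm : ph - hsq ≤ pg) (hcond : X ≤ ph - p₀)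
    (hm : m ≤ X - hsq - lb - ε) : m / g * L ^ 4 ≤ P := by
  have hL2 : 0 < L ^ 2 := by positivity
  have hL4 : 0 < L ^ 4 := by positivity
  have h1 : m ≤ (E₀ - E) / L ^ 2 := by
    rw [sub_div]
    linarith
  have h2 : (E₀ - E) / L ^ 2 ≤ (g - 0) / L ^ 2 * P / L ^ 2 :=
    div_le_div_of_nonneg_right hchord hL2.le
  have h3 : (g - 0) / L ^ 2 * P / L ^ 2 = g * P / L ^ 4 := by
    field_simp
    ring
  rw [h3] at h2
  have h4 : m * L ^ 4 ≤ g * P := by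
    have := h1.trans h2
    rwa [le_div_iff₀ hL4] at this
  rw [div_mul_eq_mul_div, div_le_iff₀ hg]
  linarith

/-- The margin at the probe source `s = e^{-a/(4U)}`, temperature `β⁻¹ = e^{-a/U}` and allowance
`ε = c a s²/(32U)`: once `1/g ≤ c a/(16U)` and `c log 2 + C + log 4 ≤ c a/(32U)`,
`c a s²/(8U) ≤ c s² log(1/(|s| + 1/β)) − C s² − s²/g − log4/β − ε`. [folklore] -/
theorem twRung_margin_zero {a c C U g β s ε : ℝ} (ha : 0 < a) (hc : 0 < c) (hU : 0 < U)
    (hβ : β = Real.exp (a / U)) (hs : s = Real.exp (-(a / (4 * U))))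
    (hginv : 1 / g ≤ c * a / (16 * U))
    (hsmall : c * Real.log 2 + C + Real.log 4 ≤ c * a / (32 * U))
    (hε : ε = c * a / (32 * U) * s ^ 2) :
    c * a * s ^ 2 / (8 * U) ≤
      c * s ^ 2 * Real.log (1 / (|s| + 1 / β)) - C * s ^ 2 - s ^ 2 / g - Real.log 4 / β - ε := by
  have hspos : 0 < s := by rw [hs]; exact Real.exp_pos _
  have hx : 0 < a / (4 * U) := by positivity
  have hs1 : s ≤ 1 := by
    rw [hs]
    exact Real.exp_le_one_iff.2 (by linarith)
  have hs2 : 0 < s ^ 2 := by positivity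
  -- `1/β = e^{-a/U} ≤ s² ≤ s`
  have hT : 1 / β = Real.exp (-(a / U)) := by rw [hβ, Real.exp_neg, one_div]
  have hss : s ^ 2 = Real.exp (-(a / (2 * U))) := by
    rw [hs, sq, ← Real.exp_add]
    congr 1
    field_simp
    ring
  have hTs2 : 1 / β ≤ s ^ 2 := by
    rw [hT, hss, Real.exp_le_exp]
    have : a / (2 * U) ≤ a / U := div_le_div_of_nonneg_left ha.le hU (by linarith)
    linarith
  have hs2s : s ^ 2 ≤ s := by nlinarith
  have hTs : 1 / β ≤ s := hTs2.trans hs2s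
  have hTpos : 0 < 1 / β := by rw [hT]; exact Real.exp_pos _
  -- the Cooper logarithm at the probe point
  have hlog : a / (4 * U) - Real.log 2 ≤ Real.log (1 / (|s| + 1 / β)) := by
    rw [abs_of_pos hspos]
    have hle : 1 / (2 * s) ≤ 1 / (s + 1 / β) :=
      one_div_le_one_div_of_le (by positivity) (by linarith)
    have hlog2s : Real.log (1 / (2 * s)) = a / (4 * U) - Real.log 2 := by
      rw [one_div, Real.log_inv, Real.log_mul two_ne_zero hspos.ne', hs, Real.log_exp]
      ring
    rw [← hlog2s]
    exact Real.log_le_log (by positivity) hle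
  -- the four estimates, written over the monomial `c a/(32U) · s²`
  have e1 : 8 * (c * a / (32 * U) * s ^ 2) - c * Real.log 2 * s ^ 2 ≤
      c * s ^ 2 * Real.log (1 / (|s| + 1 / β)) := by
    have h := mul_le_mul_of_nonneg_left hlog (show 0 ≤ c * s ^ 2 by positivity)
    have e : c * s ^ 2 * (a / (4 * U) - Real.log 2) =
        8 * (c * a / (32 * U) * s ^ 2) - c * Real.log 2 * s ^ 2 := by
      field_simp
      ring
    linarith
  have e2 : s ^ 2 / g ≤ 2 * (c * a / (32 * U) * s ^ 2) := by
    have h := mul_le_mul_of_nonneg_left hginv hs2.le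
    have e : s ^ 2 * (c * a / (16 * U)) = 2 * (c * a / (32 * U) * s ^ 2) := by
      field_simp
      ring
    rw [← div_eq_mul_one_div] at h
    linarith
  have e3 : Real.log 4 / β ≤ Real.log 4 * s ^ 2 := by
    rw [div_eq_mul_one_div]
    exact mul_le_mul_of_nonneg_left hTs2 (Real.log_nonneg (by norm_num))
  have e4 : (c * Real.log 2 + C + Real.log 4) * s ^ 2 ≤ c * a / (32 * U) * s ^ 2 :=
    mul_le_mul_of_nonneg_right hsmall hs2.le
  have e5 : c * a * s ^ 2 / (8 * U) = 4 * (c * a / (32 * U) * s ^ 2) := by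
    field_simp
    ring
  rw [hε, e5]
  nlinarith [e1, e2, e3, e4]

end Bookkeeping

section Rung

/-- **The rung from condensation and seeded ensemble equivalence alone.**
`TwSourcedCondensation → TwSeededEnsembleEquivalence → TwSeededRung`: every-ground-state `d`-wave
long-range order `⟨ψ, P_L ψ⟩ ≥ c(U,g)·L⁴` of the seeded repulsive model `H_L(U,g)` for all seeds
`g ∈ [K·U, 1/10]`, by the rung chord FROM THE PURE MODEL (`g' = 0`):
`(g/L²)⟨P_L⟩_ψ ≥ E_L(0) − E_L(g)`, with `E_L(0)/L² ≥ μn − p_L(β,μ,U,0)` (trivial Gibbs bound — no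
inertness and no approximating-Hamiltonian hard half are needed at `g' = 0`),
`E_L(g)/L² ≤ μn − p_L(β,μ,U,g) + log4/β + ε` (seeded ensemble equivalence),
`p_L(g) ≥ p̃_L(s) − s²/g` (approximating Hamiltonian, easy half) and
`p̃_L(s) − p̃_L(0) ≥ c s² log(1/(|s|+1/β)) − C s²` (condensation), at `β = e^{a/U}`,
`s = e^{-a/(4U)}`, `K = 16/(ca)`: margin `c a s²/(8U) > 0`. -/
theorem twSeededRung_of_condensation (hCond : TwSourcedCondensation)
    (hEns : TwSeededEnsembleEquivalence) : TwSeededRung := by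
  intro δ hδ
  obtain ⟨μ₁, μ₂, hμ₁, hμ₁₂, hμ₂, U₀e, hU₀e, hE⟩ := hEns δ hδ
  obtain ⟨U₀c, a, c, C, h₀, hU₀c, ha, hc, hC, hh₀, hCo⟩ := hCond μ₁ μ₂ hμ₁ hμ₁₂ hμ₂
  have hlog2 : 0 < Real.log 2 := Real.log_pos (by norm_num)
  have hlog4 : 0 < Real.log 4 := Real.log_pos (by norm_num)
  have hden : 0 < c * Real.log 2 + C + Real.log 4 := by positivity
  -- constants
  set K : ℝ := 16 / (c * a) with hKdef
  have hK : 0 < K := by positivity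
  set U₁ : ℝ := a * h₀ / 4 with hU₁def
  set U₂ : ℝ := c * a / (32 * (c * Real.log 2 + C + Real.log 4)) with hU₂def
  have hU₁ : 0 < U₁ := by positivity
  have hU₂ : 0 < U₂ := by positivity
  have h20K : 0 < 1 / (20 * K) := by positivity
  set U₀ : ℝ := min (min U₀e U₀c) (min (1 / (20 * K)) (min U₁ U₂)) with hU₀def
  have hU₀ : 0 < U₀ := lt_min (lt_min hU₀e hU₀c) (lt_min h20K (lt_min hU₁ hU₂))
  refine ⟨U₀, K, hU₀, hK, ?_, ?_⟩
  · have h1 : U₀ ≤ 1 / (20 * K) := (min_le_right _ _).trans (min_le_left _ _)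
    calc K * U₀ ≤ K * (1 / (20 * K)) := mul_le_mul_of_nonneg_left h1 hK.le
      _ = 1 / 20 := by field_simp
  intro U hU g hg
  obtain ⟨hU0, hUle⟩ := hU
  obtain ⟨hKU, hg10⟩ := hg
  have hUe : U ≤ U₀e := hUle.trans ((min_le_left _ _).trans (min_le_left _ _))
  have hUc : U ≤ U₀c := hUle.trans ((min_le_left _ _).trans (min_le_right _ _))
  have hUU₁ : U ≤ U₁ :=
    hUle.trans ((min_le_right _ _).trans ((min_le_right _ _).trans (min_le_left _ _)))
  have hUU₂ : U ≤ U₂ :=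
    hUle.trans ((min_le_right _ _).trans ((min_le_right _ _).trans (min_le_right _ _)))
  have hKUpos : 0 < K * U := mul_pos hK hU0
  have hgpos : 0 < g := hKUpos.trans_le hKU
  have hginv : 1 / g ≤ c * a / (16 * U) := by
    have h1 := one_div_le_one_div_of_le hKUpos hKU
    have e : 1 / (K * U) = c * a / (16 * U) := by
      rw [hKdef]
      field_simp
    linarith
  have hsmall : c * Real.log 2 + C + Real.log 4 ≤ c * a / (32 * U) := by
    rw [hU₂def, le_div_iff₀ (by positivity)] at hUU₂
    rw [le_div_iff₀ (by positivity)]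
    linarith
  -- temperature, probe source, allowance
  set β : ℝ := Real.exp (a / U) with hβdef
  have haU : 0 < a / U := div_pos ha hU0
  have hβ1 : 1 ≤ β := Real.one_le_exp haU.le
  have hβpos : 0 < β := Real.exp_pos _
  set s : ℝ := Real.exp (-(a / (4 * U))) with hsdef
  have hspos : 0 < s := Real.exp_pos _
  have hs_le : s ≤ h₀ := by
    have hx : 0 < a / (4 * U) := by positivity
    have h1 : a / (4 * U) + 1 ≤ Real.exp (a / (4 * U)) := Real.add_one_le_exp _
    have h2 : s = (Real.exp (a / (4 * U)))⁻¹ := by rw [hsdef, Real.exp_neg]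
    have h3 : s ≤ (a / (4 * U))⁻¹ := by
      rw [h2]
      exact inv_anti₀ hx (by linarith)
    have h4 : (a / (4 * U))⁻¹ = 4 * U / a := by rw [inv_div]
    have h5 : 4 * U / a ≤ h₀ := by
      rw [div_le_iff₀ ha]
      rw [hU₁def, le_div_iff₀ (by norm_num : (0 : ℝ) < 4)] at hUU₁
      linarith
    linarith [h4 ▸ h3]
  set ε : ℝ := c * a / (32 * U) * s ^ 2 with hεdef
  have hε : 0 < ε := by positivity
  -- the canonical chemical potential and the thresholds
  obtain ⟨μ, hμ, hE'⟩ := hE U ⟨hU0, hUe⟩ g ⟨hgpos, hg10⟩ β hβ1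
  obtain ⟨L₁, hL₁⟩ := hE' ε hε
  obtain ⟨L₂, hL₂⟩ := hCo U hU0 hUc β hβ1 le_rfl μ hμ
  refine ⟨c * a * s ^ 2 / (8 * U) / g, by positivity, max L₁ L₂, ?_⟩
  intro L _ hL _hEven ψ hψ hgs
  have hL1 : L₁ ≤ L := (le_max_left _ _).trans hL
  have hL2 : L₂ ≤ L := (le_max_right _ _).trans hL
  have hLpos : (0 : ℝ) < (L : ℝ) := by exact_mod_cast NeZero.pos L
  -- the rung chord from the pure model
  have hchord := leftChord_le_order (U := U) (g := g) (g' := 0) hgpos hψ hgs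
  -- the Gibbs lower bound on the pure sector energy
  have hn : ⌊(1 - δ) * (L : ℝ) ^ 2 / 2⌋₊ ≤ Fintype.card (FermionTorus 2 L) :=
    le_card_of_mem_szSector L hgs.1 hgs.2.1
  have hlow := tw_lower_aux hβpos hLpos (tw_sectorEnergy_zero_lower_bound L U μ hβpos.le hn)
  have hn' : μ * ((2 * ⌊(1 - δ) * (L : ℝ) ^ 2 / 2⌋₊ : ℕ) : ℝ) / (L : ℝ) ^ 2 =
      μ * ((2 * ⌊(1 - δ) * (L : ℝ) ^ 2 / 2⌋₊) : ℝ) / (L : ℝ) ^ 2 := by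
    push_cast
    ring
  rw [hn'] at hlow
  -- seeded ensemble equivalence, approximating Hamiltonian (easy half), condensation
  have hup := hL₁ L hL1
  have hahm := tw_sourcedPressure_sub_sq_le_seededPressure L U μ hβpos hgpos s
  have hcond := hL₂ L hL2 s (by rw [abs_of_pos hspos]; exact hs_le)
  rw [dWaveSourceTorus_zero] at hcond
  -- margin and bookkeeping
  have hm := twRung_margin_zero (g := g) ha hc hU0 hβdef hsdef hginv hsmall hεdef
  exact twRung_bookkeeping_zero hLpos hgpos hchord hlow hup hahm hcond hm

end Rung


end Summit.HubbardSuperconductivity.HubbardSuperconductivity.Theorems
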